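import Literature.Computability.QuantumComplexity.RevExprCompile
import Literature.Computability.QuantumComplexity.SandwichBlock
import Literature.Computability.QuantumComplexity.OAAWord
import Literature.Computability.QuantumComplexity.RevTableau
import Literature.Computability.Complexity.StackWordArith
import HarnessLib

/-!
# The flag of a gadget: a compiled Boolean expression read on the labels of the sandwich

Topic `Literature/Computability/QuantumComplexity`; a step in the discharge of
`ajl_jonesApproxProblem_mem_PromiseBQP`. The hypothesis `hflag` of `GadgetAssembly.rotGadget_implOn`
is discharged for flag programs obtained from Boolean expressions (`RevExprCompile.lean`): with the
layout `L` reading the `k` averaging wires `as`, then the column wire `c`, the target `t` and the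
control wire `f` (`GadgetLayout`), the program `gadgetOps = (SLP.compile L (b.compile Wd 0 0).1).map (map finOf)`
satisfies, on every label `writeNat as (z[c ↦ bb]) n` with `z` clean on the layout region,

  `clEval gadgetOps _ (flag wire) = b.eval (2^k · (bb + 2·z t + 4·z f) + n)`   (`clEval_gadgetOps_flag`),

by `SLP.BExpr.clEval_compile` transported along `RevSim.finOf` (`RevTableau.lean`). Also: the wires of
compiled straight-line programs stay inside the layout (`SLP.lt_of_mem_wiresOf_compile`), and the
region list `layoutRegion`; numbers spelled by bit lists are the canonical `Complexity.bitsToNat`.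

## References

* V. Vedral, A. Barenco, A. Ekert, Phys. Rev. A 54 (1996), §3 [VedralBarencoEkert1996].
* M. A. Nielsen, I. L. Chuang, *Quantum Computation and Quantum Information*, CUP 2010, §3.2.5
  [NielsenChuang2010].
-/

namespace Literature.Computability.QuantumComplexity

open RevSim
open Literature.Computability.Complexity (bitsToNat bitsToNat_cons)
open Literature.Computability.Complexity.Com (testBit_bitsToNat)

/-! ### Wires of compiled straight-line programs -/

namespace SLP

variable {Wd : ℕ} (L : Layout) {R F T : ℕ}

/-- A bound for all wires of the layout: registers, flags and `T` scratch blocks below `M`, input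
wires below `M`. [folklore] -/
structure Layout.Below (L : Layout) (Wd R F T M : ℕ) : Prop where
  /-- the layout is valid -/
  valid : L.Valid Wd R F
  /-- the scratch blocks end below `M` -/
  sb_le : L.sb + T * scrSize Wd ≤ M
  /-- input wires are below `M` -/
  iw_lt : ∀ j, j < L.kIn → L.iw j < M

variable {L} {M : ℕ}

/-- Register wires are below the bound. [folklore] -/
theorem Layout.Below.regW_lt (hB : L.Below Wd R F T M) {ρ j : ℕ} (hρ : ρ < R) (hj : j < Wd) : L.regW (Wd := Wd) ρ j < M := by
  have := (Layout.regW_bounds (L := L) hρ hj).2; have := hB.valid.fb_ge; have := hB.valid.sb_ge; have := hB.sb_le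
  have : 0 ≤ T * scrSize Wd := Nat.zero_le _; omega

/-- Flag wires are below the bound. [folklore] -/
theorem Layout.Below.flagW_lt (hB : L.Below Wd R F T M) {φ : ℕ} (hφ : φ < F) : L.flagW φ < M := by
  have := hB.valid.sb_ge; have := hB.sb_le; simp only [Layout.flagW]; have : 0 ≤ T * scrSize Wd := Nat.zero_le _; omega

/-- Scratch wires are below the bound. [folklore] -/
theorem Layout.Below.scrW_lt (hB : L.Below Wd R F T M) {t o : ℕ} (ht : t < T) (ho : o < scrSize Wd) : L.scrW (Wd := Wd) t o < M := by
  have h1 := (Layout.scrW_bounds (L := L) (t := t) ho).2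
  have h2 : (t + 1) * scrSize Wd ≤ T * scrSize Wd := Nat.mul_le_mul_right _ ht
  have := hB.sb_le; omega

/-- The wires of a layout: registers below `R`, flags below `F`, scratch blocks below `T`, inputs.
[folklore] -/
def LayoutWire (L : Layout) (Wd R F T : ℕ) (i : ℕ) : Prop :=
  (∃ ρ j, ρ < R ∧ j < Wd ∧ i = L.regW (Wd := Wd) ρ j) ∨ (∃ φ, φ < F ∧ i = L.flagW φ) ∨
    (∃ t o, t < T ∧ o < scrSize Wd ∧ i = L.scrW (Wd := Wd) t o) ∨ (∃ j, j < L.kIn ∧ i = L.iw j)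

/-- Layout wires are below the bound. [folklore] -/
theorem LayoutWire.lt (hB : L.Below Wd R F T M) {i : ℕ} (h : LayoutWire L Wd R F T i) : i < M := by
  rcases h with ⟨ρ, j, hρ, hj, rfl⟩ | ⟨φ, hφ, rfl⟩ | ⟨t, o, ht, ho, rfl⟩ | ⟨j, hj, rfl⟩
  · exact hB.regW_lt hρ hj
  · exact hB.flagW_lt hφ
  · exact hB.scrW_lt ht ho
  · exact hB.iw_lt j hj

/-- **Wires of one compiled instruction are layout wires.** [folklore] -/
theorem layoutWire_of_mem_wiresOf_compileInstr {t : ℕ} (ht : t < T) :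
    ∀ (ins : Instr), ins.Shape Wd L.kIn R F → ∀ op ∈ compileInstr L (Wd := Wd) t ins, ∀ i ∈ wiresOf op, LayoutWire L Wd R F T i
  | .copyIn d off len, hsh, op, hop, i, hi => by
    obtain ⟨hd, hol, hlen⟩ := hsh
    simp only [compileInstr, List.mem_map, List.mem_range] at hop
    obtain ⟨j, hj, rfl⟩ := hop
    simp only [mem_wiresOf, ClOp.target, ClOp.controls, List.mem_singleton] at hi
    rcases hi with rfl | rfl
    · exact Or.inl ⟨d, j, hd, by omega, rfl⟩
    · exact Or.inr (Or.inr (Or.inr ⟨off + j, by omega, rfl⟩))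
  | .setBit d i', hsh, op, hop, i, hi => by
    simp only [compileInstr] at hop
    split_ifs at hop with h
    · simp only [List.mem_singleton] at hop; subst hop
      simp only [mem_wiresOf, ClOp.target, ClOp.controls, List.not_mem_nil, or_false] at hi
      subst hi; exact Or.inl ⟨d, i', hsh, h, rfl⟩
    · simp at hop
  | .add d a b sh, hsh, op, hop, i, hi => by
    obtain ⟨hd, ha, hb, -, -, -⟩ := hsh
    simp only [compileInstr, List.mem_map] at hop
    obtain ⟨op', hop', rfl⟩ := hop
    have himg : ∃ x, i = L.addEmb (Wd := Wd) t d a b sh x := by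
      cases op' with
      | not x => simp [ClOp.map, mem_wiresOf, ClOp.target, ClOp.controls] at hi; exact ⟨x, hi⟩
      | cnot x y => simp [ClOp.map, mem_wiresOf, ClOp.target, ClOp.controls] at hi; rcases hi with rfl | rfl <;> exact ⟨_, rfl⟩
      | toffoli x y w =>
        simp [ClOp.map, mem_wiresOf, ClOp.target, ClOp.controls] at hi; rcases hi with rfl | rfl | rfl <;> exact ⟨_, rfl⟩
    obtain ⟨x, rfl⟩ := himg
    cases x with
    | a j => exact Or.inl ⟨a, j, ha, j.2, rfl⟩
    | b j =>
      simp only [Layout.addEmb]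
      split_ifs with hs
      · exact Or.inl ⟨b, j - sh, hb, by omega, rfl⟩
      · exact Or.inr (Or.inr (Or.inl ⟨t, Wd + 1 + j, ht, by unfold scrSize; omega, Layout.zerW_eq L t j⟩))
    | s j => exact Or.inl ⟨d, j, hd, j.2, rfl⟩
    | c j => exact Or.inr (Or.inr (Or.inl ⟨t, j, ht, by unfold scrSize; omega, Layout.carW_eq L t j⟩))
  | .andBit d x i' y, hsh, op, hop, i, hi => by
    obtain ⟨hd, hx, hy, -, -, -, hi'⟩ := hsh
    simp only [compileInstr, List.mem_map, List.mem_range] at hop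
    obtain ⟨j, hj, rfl⟩ := hop
    simp only [mem_wiresOf, ClOp.target, ClOp.controls, List.mem_cons, List.not_mem_nil, or_false] at hi
    rcases hi with rfl | rfl | rfl
    · exact Or.inl ⟨d, j, hd, hj, rfl⟩
    · exact Or.inl ⟨x, i', hx, hi', rfl⟩
    · exact Or.inl ⟨y, j, hy, hj, rfl⟩
  | .lt f a b, hsh, op, hop, i, hi => by
    obtain ⟨hf, ha, hb, -⟩ := hsh
    simp only [compileInstr, List.mem_append, List.mem_map, List.mem_singleton] at hop
    rcases hop with ⟨op', hop', rfl⟩ | rfl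
    · have himg : ∃ x, i = L.ltEmb (Wd := Wd) t a b x := by
        cases op' with
        | not x => simp [ClOp.map, mem_wiresOf, ClOp.target, ClOp.controls] at hi; exact ⟨x, hi⟩
        | cnot x y => simp [ClOp.map, mem_wiresOf, ClOp.target, ClOp.controls] at hi; rcases hi with rfl | rfl <;> exact ⟨_, rfl⟩
        | toffoli x y w =>
          simp [ClOp.map, mem_wiresOf, ClOp.target, ClOp.controls] at hi; rcases hi with rfl | rfl | rfl <;> exact ⟨_, rfl⟩
      obtain ⟨x, rfl⟩ := himg
      cases x with
      | a j => exact Or.inl ⟨b, j, hb, j.2, rfl⟩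
      | b j => exact Or.inl ⟨a, j, ha, j.2, rfl⟩
      | s j => exact Or.inr (Or.inr (Or.inl ⟨t, 2 * Wd + 1 + j, ht, by unfold scrSize; omega, Layout.sumW_eq L t j⟩))
      | c j => exact Or.inr (Or.inr (Or.inl ⟨t, j, ht, by unfold scrSize; omega, Layout.carW_eq L t j⟩))
    · simp only [mem_wiresOf, ClOp.target, ClOp.controls, List.mem_singleton] at hi
      rcases hi with rfl | rfl
      · exact Or.inr (Or.inl ⟨f, hf, rfl⟩)
      · exact Or.inr (Or.inr (Or.inl ⟨t, Wd, ht, by unfold scrSize; omega, rfl⟩))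
  | .fnot f g, hsh, op, hop, i, hi => by
    obtain ⟨hf, hg, -⟩ := hsh
    simp only [compileInstr, List.mem_cons, List.not_mem_nil, or_false] at hop
    rcases hop with rfl | rfl
    · simp only [mem_wiresOf, ClOp.target, ClOp.controls, List.mem_singleton] at hi
      rcases hi with rfl | rfl
      · exact Or.inr (Or.inl ⟨f, hf, rfl⟩)
      · exact Or.inr (Or.inl ⟨g, hg, rfl⟩)
    · simp only [mem_wiresOf, ClOp.target, ClOp.controls, List.not_mem_nil, or_false] at hi
      subst hi; exact Or.inr (Or.inl ⟨f, hf, rfl⟩)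
  | .fand f g h, hsh, op, hop, i, hi => by
    obtain ⟨hf, hg, hh, -⟩ := hsh
    simp only [compileInstr, List.mem_singleton] at hop
    subst hop
    simp only [mem_wiresOf, ClOp.target, ClOp.controls, List.mem_cons, List.not_mem_nil, or_false] at hi
    rcases hi with rfl | rfl | rfl
    · exact Or.inr (Or.inl ⟨f, hf, rfl⟩)
    · exact Or.inr (Or.inl ⟨g, hg, rfl⟩)
    · exact Or.inr (Or.inl ⟨h, hh, rfl⟩)
  | .forr f g h, hsh, op, hop, i, hi => by
    obtain ⟨hf, hg, hh, -⟩ := hsh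
    simp only [compileInstr, List.mem_cons, List.not_mem_nil, or_false] at hop
    rcases hop with rfl | rfl | rfl | rfl | rfl | rfl <;>
      simp only [mem_wiresOf, ClOp.target, ClOp.controls, List.mem_cons, List.not_mem_nil, or_false] at hi
    · subst hi; exact Or.inr (Or.inl ⟨g, hg, rfl⟩)
    · subst hi; exact Or.inr (Or.inl ⟨h, hh, rfl⟩)
    · rcases hi with rfl | rfl | rfl
      · exact Or.inr (Or.inl ⟨f, hf, rfl⟩)
      · exact Or.inr (Or.inl ⟨g, hg, rfl⟩)
      · exact Or.inr (Or.inl ⟨h, hh, rfl⟩)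
    · subst hi; exact Or.inr (Or.inl ⟨f, hf, rfl⟩)
    · subst hi; exact Or.inr (Or.inl ⟨g, hg, rfl⟩)
    · subst hi; exact Or.inr (Or.inl ⟨h, hh, rfl⟩)

/-- **Wires of a compiled program are layout wires.** [folklore] -/
theorem layoutWire_of_mem_wiresOf_compileFrom : ∀ (p : List Instr) (t : ℕ), t + p.length ≤ T →
    (∀ ins ∈ p, ins.Shape Wd L.kIn R F) → ∀ op ∈ compileFrom L (Wd := Wd) t p, ∀ i ∈ wiresOf op, LayoutWire L Wd R F T i
  | [], _, _, _, op, hop, _, _ => by simp [compileFrom] at hop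
  | ins :: p, t, hT, hsh, op, hop, i, hi => by
    rw [compileFrom, List.mem_append] at hop
    rcases hop with hop | hop
    · exact layoutWire_of_mem_wiresOf_compileInstr (by simp at hT; omega) ins (hsh ins (by simp)) op hop i hi
    · exact layoutWire_of_mem_wiresOf_compileFrom p (t + 1) (by simp at hT ⊢; omega) (fun i hi => hsh i (by simp [hi])) op hop i hi

/-- Wires of `compile L p` are layout wires. [folklore] -/
theorem layoutWire_of_mem_wiresOf_compile {p : List Instr} (hp : ProgWF Wd L.kIn R F p) (hT : p.length ≤ T) :
    ∀ op ∈ compile L (Wd := Wd) p, ∀ i ∈ wiresOf op, LayoutWire L Wd R F T i :=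
  layoutWire_of_mem_wiresOf_compileFrom p 0 (by simpa using hT) hp.shape

/-- Wires of `compile L p` are below the bound. [folklore] -/
theorem lt_of_mem_wiresOf_compile (hB : L.Below Wd R F T M) {p : List Instr} (hp : ProgWF Wd L.kIn R F p) (hT : p.length ≤ T) :
    ∀ op ∈ compile L (Wd := Wd) p, ∀ i ∈ wiresOf op, i < M := fun op hop i hi =>
  (layoutWire_of_mem_wiresOf_compile hp hT op hop i hi).lt hB

/-- **Operations of one compiled instruction are well formed.** [folklore] -/
theorem wf_of_mem_compileInstr (hV : L.Valid Wd R F) (t : ℕ) :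
    ∀ (ins : Instr), ins.Shape Wd L.kIn R F → ∀ op ∈ compileInstr L (Wd := Wd) t ins, op.WF
  | .copyIn d off len, hsh, op, hop => by
    obtain ⟨hd, hol, hlen⟩ := hsh
    simp only [compileInstr, List.mem_map, List.mem_range] at hop
    obtain ⟨j, hj, rfl⟩ := hop
    exact Layout.iw_ne_regW hV (by omega)
  | .setBit d i', hsh, op, hop => by
    simp only [compileInstr] at hop
    split_ifs at hop
    · simp only [List.mem_singleton] at hop; subst hop; trivial
    · simp at hop
  | .add d a b sh, hsh, op, hop => by
    obtain ⟨hd, ha, hb, hda, hdb, hab⟩ := hsh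
    simp only [compileInstr, List.mem_map] at hop
    obtain ⟨op', hop', rfl⟩ := hop
    exact ClOp.WF.map (Layout.addEmb_injective hV hd ha hb hda hdb hab) (addOps_wf (m := Wd) op' hop')
  | .andBit d x i' y, hsh, op, hop => by
    obtain ⟨hd, hx, hy, hdx, hdy, hxy, hi'⟩ := hsh
    simp only [compileInstr, List.mem_map, List.mem_range] at hop
    obtain ⟨j, hj, rfl⟩ := hop
    refine ⟨fun e => hxy (Layout.regW_inj hi' hj e).1, fun e => hdx (Layout.regW_inj hi' hj e).1.symm, fun e => hdy (Layout.regW_inj hj hj e).1.symm⟩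
  | .lt f a b, hsh, op, hop => by
    obtain ⟨hf, ha, hb, hab⟩ := hsh
    simp only [compileInstr, List.mem_append, List.mem_map, List.mem_singleton] at hop
    rcases hop with ⟨op', hop', rfl⟩ | rfl
    · exact ClOp.WF.map (Layout.ltEmb_injective hV ha hb hab) (ltOps_wf (m := Wd) op' hop')
    · exact fun e => Layout.flagW_ne_scrW hV hf e.symm
  | .fnot f g, hsh, op, hop => by
    obtain ⟨hf, hg, hfg⟩ := hsh
    simp only [compileInstr, List.mem_cons, List.not_mem_nil, or_false] at hop
    rcases hop with rfl | rfl
    · exact fun e => hfg (flagW_injective e).symm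
    · trivial
  | .fand f g h, hsh, op, hop => by
    obtain ⟨hf, hg, hh, hfg, hfh, hgh⟩ := hsh
    simp only [compileInstr, List.mem_singleton] at hop
    subst hop
    exact ⟨fun e => hgh (flagW_injective e), fun e => hfg (flagW_injective e).symm, fun e => hfh (flagW_injective e).symm⟩
  | .forr f g h, hsh, op, hop => by
    obtain ⟨hf, hg, hh, hfg, hfh, hgh⟩ := hsh
    simp only [compileInstr, List.mem_cons, List.not_mem_nil, or_false] at hop
    rcases hop with rfl | rfl | rfl | rfl | rfl | rfl
    · trivial
    · trivial
    · exact ⟨fun e => hgh (flagW_injective e), fun e => hfg (flagW_injective e).symm, fun e => hfh (flagW_injective e).symm⟩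
    · trivial
    · trivial
    · trivial

/-- Operations of a compiled program are well formed. [folklore] -/
theorem wf_of_mem_compileFrom (hV : L.Valid Wd R F) : ∀ (p : List Instr) (t : ℕ), (∀ ins ∈ p, ins.Shape Wd L.kIn R F) →
    ∀ op ∈ compileFrom L (Wd := Wd) t p, op.WF
  | [], _, _, op, hop => by simp [compileFrom] at hop
  | ins :: p, t, hsh, op, hop => by
    rw [compileFrom, List.mem_append] at hop
    rcases hop with hop | hop
    · exact wf_of_mem_compileInstr hV t ins (hsh ins (by simp)) op hop
    · exact wf_of_mem_compileFrom hV p (t + 1) (fun i hi => hsh i (by simp [hi])) op hop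

/-- **Every operation of a compiled well-formed program is well formed.** [folklore] -/
theorem wf_of_mem_compile (hV : L.Valid Wd R F) {p : List Instr} (hp : ProgWF Wd L.kIn R F p) :
    ∀ op ∈ compile L (Wd := Wd) p, op.WF :=
  wf_of_mem_compileFrom hV p 0 hp.shape

/-- **Targets of one compiled instruction are at or above the register base** (valid layout).
[folklore] -/
theorem rb_le_target_of_mem_compileInstr (hV : L.Valid Wd R F) (t : ℕ) :
    ∀ (ins : Instr) (op : ClOp ℕ), op ∈ compileInstr L (Wd := Wd) t ins → L.rb ≤ op.target
  | .copyIn d off len, op, hop => by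
    simp only [compileInstr, List.mem_map, List.mem_range] at hop
    obtain ⟨j, hj, rfl⟩ := hop
    simp [ClOp.target, Layout.regW, Nat.add_assoc]
  | .setBit d i', op, hop => by
    simp only [compileInstr] at hop
    split_ifs at hop
    · simp only [List.mem_singleton] at hop; subst hop; simp [ClOp.target, Layout.regW, Nat.add_assoc]
    · simp at hop
  | .add d a b sh, op, hop => by
    have h1 := hV.fb_ge; have h2 := hV.sb_ge
    simp only [compileInstr, List.mem_map] at hop
    obtain ⟨op', hop', rfl⟩ := hop
    rw [ClOp.target_map]
    cases op'.target with
    | a j => simp [Layout.addEmb, Layout.regW, Nat.add_assoc]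
    | b j =>
      simp only [Layout.addEmb]
      split_ifs
      · simp [Layout.regW, Nat.add_assoc]
      · simp only [Layout.zerW]; have : 0 ≤ R * Wd := Nat.zero_le _; omega
    | s j => simp [Layout.addEmb, Layout.regW, Nat.add_assoc]
    | c j => show L.rb ≤ L.carW (Wd := Wd) t j; simp only [Layout.carW]; have : 0 ≤ R * Wd := Nat.zero_le _; omega
  | .andBit d x i' y, op, hop => by
    simp only [compileInstr, List.mem_map, List.mem_range] at hop
    obtain ⟨j, hj, rfl⟩ := hop
    simp [ClOp.target, Layout.regW, Nat.add_assoc]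
  | .lt f a b, op, hop => by
    have h1 := hV.fb_ge; have h2 := hV.sb_ge
    simp only [compileInstr, List.mem_append, List.mem_map, List.mem_singleton] at hop
    rcases hop with ⟨op', hop', rfl⟩ | rfl
    · rw [ClOp.target_map]
      cases op'.target with
      | a j => simp [Layout.ltEmb, Layout.regW, Nat.add_assoc]
      | b j => simp [Layout.ltEmb, Layout.regW, Nat.add_assoc]
      | s j => show L.rb ≤ L.sumW (Wd := Wd) t j; simp only [Layout.sumW]; have : 0 ≤ R * Wd := Nat.zero_le _; omega
      | c j => show L.rb ≤ L.carW (Wd := Wd) t j; simp only [Layout.carW]; have : 0 ≤ R * Wd := Nat.zero_le _; omega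
    · simp only [ClOp.target, Layout.flagW]; have : 0 ≤ R * Wd := Nat.zero_le _; omega
  | .fnot f g, op, hop => by
    have h1 := hV.fb_ge
    simp only [compileInstr, List.mem_cons, List.not_mem_nil, or_false] at hop
    rcases hop with rfl | rfl <;> · simp only [ClOp.target, Layout.flagW]; have : 0 ≤ R * Wd := Nat.zero_le _; omega
  | .fand f g h, op, hop => by
    have h1 := hV.fb_ge
    simp only [compileInstr, List.mem_singleton] at hop
    subst hop; simp only [ClOp.target, Layout.flagW]; have : 0 ≤ R * Wd := Nat.zero_le _; omega
  | .forr f g h, op, hop => by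
    have h1 := hV.fb_ge
    simp only [compileInstr, List.mem_cons, List.not_mem_nil, or_false] at hop
    rcases hop with rfl | rfl | rfl | rfl | rfl | rfl <;>
      · simp only [ClOp.target, Layout.flagW]; have : 0 ≤ R * Wd := Nat.zero_le _; omega

/-- Targets of a compiled program are at or above the register base. [folklore] -/
theorem rb_le_target_of_mem_compileFrom (hV : L.Valid Wd R F) : ∀ (p : List Instr) (t : ℕ) (op : ClOp ℕ),
    op ∈ compileFrom L (Wd := Wd) t p → L.rb ≤ op.target
  | [], _, op, hop => by simp [compileFrom] at hop
  | ins :: p, t, op, hop => by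
    rw [compileFrom, List.mem_append] at hop
    rcases hop with hop | hop
    · exact rb_le_target_of_mem_compileInstr hV t ins op hop
    · exact rb_le_target_of_mem_compileFrom hV p (t + 1) op hop

/-- **Targets of `compile L p` are at or above the register base** (so input wires are never
targets). [folklore] -/
theorem rb_le_target_of_mem_compile (hV : L.Valid Wd R F) {p : List Instr} : ∀ op ∈ compile L (Wd := Wd) p, L.rb ≤ op.target :=
  fun op hop => rb_le_target_of_mem_compileFrom hV p 0 op hop

end SLP

/-! ### The gadget's flag program and its value on the labels of the sandwich -/

section Flag

variable {N : ℕ} (hN : 0 < N) {Wd : ℕ} (L : SLP.Layout) (R F T : ℕ)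

/-- The layout region (registers, flags, scratch) as wires of `Fin N`. [folklore] -/
def layoutRegion : List (Fin N) :=
  ((List.range (R * Wd)).map (fun i => L.rb + i) ++ (List.range F).map (fun i => L.fb + i) ++
    (List.range (T * SLP.scrSize Wd)).map (fun i => L.sb + i)).map (finOf N hN)

variable {R F T}

/-- Register wires lie in the region. [folklore] -/
theorem regW_mem_layoutRegion {ρ j : ℕ} (hρ : ρ < R) (hj : j < Wd) :
    finOf N hN (L.regW (Wd := Wd) ρ j) ∈ layoutRegion hN L R F T (Wd := Wd) := by
  refine List.mem_map.2 ⟨L.regW (Wd := Wd) ρ j, ?_, rfl⟩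
  simp only [List.mem_append, List.mem_map, List.mem_range]
  refine Or.inl (Or.inl ⟨ρ * Wd + j, ?_, by simp [SLP.Layout.regW, Nat.add_assoc]⟩)
  calc ρ * Wd + j < ρ * Wd + Wd := by omega
    _ = (ρ + 1) * Wd := by ring
    _ ≤ R * Wd := Nat.mul_le_mul_right _ hρ

/-- Flag wires lie in the region. [folklore] -/
theorem flagW_mem_layoutRegion {φ : ℕ} (hφ : φ < F) : finOf N hN (L.flagW φ) ∈ layoutRegion hN L R F T (Wd := Wd) := by
  refine List.mem_map.2 ⟨L.flagW φ, ?_, rfl⟩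
  simp only [List.mem_append, List.mem_map, List.mem_range]
  exact Or.inl (Or.inr ⟨φ, hφ, rfl⟩)

/-- Scratch wires lie in the region. [folklore] -/
theorem scrW_mem_layoutRegion {t o : ℕ} (ht : t < T) (ho : o < SLP.scrSize Wd) :
    finOf N hN (L.scrW (Wd := Wd) t o) ∈ layoutRegion hN L R F T (Wd := Wd) := by
  refine List.mem_map.2 ⟨L.scrW (Wd := Wd) t o, ?_, rfl⟩
  simp only [List.mem_append, List.mem_map, List.mem_range]
  refine Or.inr ⟨t * SLP.scrSize Wd + o, ?_, by simp [SLP.Layout.scrW, Nat.add_assoc]⟩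
  calc t * SLP.scrSize Wd + o < t * SLP.scrSize Wd + SLP.scrSize Wd := by omega
    _ = (t + 1) * SLP.scrSize Wd := by ring
    _ ≤ T * SLP.scrSize Wd := Nat.mul_le_mul_right _ ht

/-- **The gadget's flag program**: a Boolean expression compiled, laid out, re-indexed to `Fin N`.
[folklore] -/
def gadgetOps (b : SLP.BExpr) : List (ClOp (Fin N)) :=
  (SLP.compile L (Wd := Wd) (b.compile Wd 0 0).1).map (ClOp.map (finOf N hN))

/-- The flag wire of the gadget's program. [folklore] -/
def gadgetFlag (b : SLP.BExpr) : Fin N := finOf N hN (L.flagW (b.compile Wd 0 0).2.1)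

/-- **The geometry of a gadget's flag program**: the layout sits below `N` and reads the `k`
averaging wires `as`, then the column (or selector) wire `c`, then the further input wires `ins`
(target, controls, vertex registers, …). [folklore] -/
structure GadgetLayout (hN : 0 < N) (L : SLP.Layout) (Wd R F T k : ℕ) (as : List (Fin N)) (c : Fin N) (ins : List (Fin N)) : Prop where
  /-- all layout wires are below `N` -/
  below : L.Below Wd R F T N
  /-- the input has `k + 1 + |ins|` bits -/
  kIn : L.kIn = k + 1 + ins.length
  /-- there are `k` averaging wires -/
  len : as.length = k
  /-- the first `k` input wires are the averaging wires -/
  iw_as : ∀ (j : ℕ) (hj : j < as.length), L.iw j = (as[j] : ℕ)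
  /-- then the column / selector wire -/
  iw_c : L.iw k = c
  /-- then the further inputs -/
  iw_ins : ∀ (j : ℕ) (hj : j < ins.length), L.iw (k + 1 + j) = (ins[j] : ℕ)
  /-- the averaging wires are distinct -/
  nodup : as.Nodup
  /-- `c` is not an averaging wire -/
  c_notin : c ∉ as
  /-- the further inputs are neither averaging wires nor `c` -/
  ins_off : ∀ i ∈ ins, i ∉ as ∧ i ≠ c

variable {hN L} {k : ℕ} {as : List (Fin N)} {c : Fin N} {ins : List (Fin N)}

/-- Input wires, being below the register block, are not in the region. [folklore] -/
theorem GadgetLayout.val_lt_rb (G : GadgetLayout hN L Wd R F T k as c ins) {j : ℕ} (hj : j < k + 1 + ins.length) : L.iw j < L.rb :=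
  G.below.valid.iw_lt j (by rw [G.kIn]; exact hj)

/-- **The high part of the gadget input**: the column bit, then the further inputs read off the
label. [folklore] -/
def hiNum (bb : Bool) (z : Cryptography.QReg N) (ins : List (Fin N)) : ℕ := bitsToNat (bb :: ins.map z)

/-- Bit `0` of the high part is the column bit. [folklore] -/
theorem testBit_hiNum_zero (bb : Bool) (z : Cryptography.QReg N) (ins : List (Fin N)) : (hiNum bb z ins).testBit 0 = bb := by
  rw [hiNum, testBit_bitsToNat]; rfl

/-- Bit `1 + j` of the high part is the `j`-th further input. [folklore] -/
theorem testBit_hiNum_succ (bb : Bool) (z : Cryptography.QReg N) (ins : List (Fin N)) (j : ℕ) (hj : j < ins.length) :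
    (hiNum bb z ins).testBit (1 + j) = z (ins[j]) := by
  rw [hiNum, testBit_bitsToNat, Nat.add_comm, List.getD_cons_succ, List.getD_eq_getElem?_getD, List.getElem?_map,
    List.getElem?_eq_getElem hj]
  rfl

/-- **The flag of the gadget on the labels of the sandwich.** For `z` clean on the layout region,
the flag program run on `writeNat as (z[c ↦ bb]) n` (`n < 2^k`) leaves on the flag wire the value of
the Boolean expression at the input `2^k · hiNum bb z ins + n`. [folklore] -/
theorem clEval_gadgetOps_flag (G : GadgetLayout hN L Wd R F T k as c ins) (b : SLP.BExpr) (hok : b.OK Wd (k + 1 + ins.length))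
    (hR : (b.compile Wd 0 0).2.2.1 ≤ R) (hF : (b.compile Wd 0 0).2.2.2 ≤ F) (hmax : b.maxBnd < 2 ^ Wd)
    (hT : (b.compile Wd 0 0).1.length ≤ T) {z : Cryptography.QReg N} (hz : z ∈ cleanOn (layoutRegion hN L R F T (Wd := Wd)))
    (bb : Bool) {n : ℕ} (hn : n < 2 ^ k) :
    clEval (gadgetOps hN L b (Wd := Wd)) (writeNat as (Function.update z c bb) n) (gadgetFlag hN L b (Wd := Wd)) =
      b.eval (2 ^ k * hiNum bb z ins + n) := by
  set y := writeNat as (Function.update z c bb) n with hy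
  set prog := SLP.compile L (Wd := Wd) (b.compile Wd 0 0).1 with hprog
  have hV := G.below.valid
  have hok' : b.OK Wd L.kIn := by rw [G.kIn]; exact hok
  have hwf := (b.progWF_compile Wd 0 0 hok' hR hF)
  have hwires : ∀ op ∈ prog, ∀ i ∈ wiresOf op, i < N := SLP.lt_of_mem_wiresOf_compile G.below hwf hT
  -- values of `y`
  have hyoff : ∀ j : Fin N, j ∉ as → j ≠ c → y j = z j := fun j hj hjc => by
    rw [hy, writeNat_apply_of_not_mem as _ _ hj, Function.update_of_ne hjc]
  have hyas : ∀ (j : ℕ) (hj : j < as.length), y (as[j]) = n.testBit j := fun j hj => writeNat_getElem as G.nodup _ n j hj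
  have hyc : y c = bb := by rw [hy, writeNat_apply_of_not_mem as _ _ G.c_notin, Function.update_self]
  -- region wires of `y` are clean
  have hyregion : ∀ i : ℕ, (hi : i < N) → finOf N hN i ∈ layoutRegion hN L R F T (Wd := Wd) → L.rb ≤ i → liftW y i = false := by
    intro i hi hmem hrb
    have e : liftW y i = y (finOf N hN i) := by rw [finOf_of_lt hN hi]; simp [liftW, hi]
    rw [e, hyoff]
    · exact hz _ hmem
    · intro hmem'
      obtain ⟨j, hj, hji⟩ := List.getElem_of_mem hmem'
      have h1 := G.iw_as j hj
      rw [hji, val_finOf_of_lt hN hi] at h1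
      have := G.val_lt_rb (j := j) (by rw [← G.len]; omega)
      omega
    · intro e'
      have h1 := G.iw_c
      rw [← e', val_finOf_of_lt hN hi] at h1
      have := G.val_lt_rb (j := k) (by omega)
      omega
  -- the compiler correctness theorem on `liftW y`
  set inp := 2 ^ k * hiNum bb z ins + n with hinp
  have key := (SLP.BExpr.clEval_compile hV b hok' hR hF hmax hT (inp := inp) (w := liftW y)
    (fun ρ hρ j hj => hyregion _ (G.below.regW_lt hρ hj) (regW_mem_layoutRegion hN L hρ hj) (SLP.Layout.regW_bounds (L := L) hρ hj).1)
    (fun φ hφ => hyregion _ (G.below.flagW_lt hφ) (flagW_mem_layoutRegion hN L hφ)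
      (by have := hV.fb_ge; simp only [SLP.Layout.flagW]; have : 0 ≤ R * Wd := Nat.zero_le _; omega))
    (fun t' ht' o ho => hyregion _ (G.below.scrW_lt ht' ho) (scrW_mem_layoutRegion hN L ht' ho)
      (by have := hV.fb_ge; have := hV.sb_ge; simp only [SLP.Layout.scrW]; have : 0 ≤ R * Wd := Nat.zero_le _; omega))
    (fun j hj => ?_)).1
  · -- transport along `finOf`
    rw [gadgetOps, gadgetFlag, clEval_map_finOf_apply hN prog hwires y, val_finOf_of_lt hN (G.below.flagW_lt (by have := b.compile_bounds Wd 0 0; omega))]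
    exact key
  · -- the input wires carry `inp`
    rw [G.kIn] at hj
    have hiw : L.iw j < N := G.below.iw_lt j (by rw [G.kIn]; exact hj)
    have e : liftW y (L.iw j) = y (finOf N hN (L.iw j)) := by rw [finOf_of_lt hN hiw]; simp [liftW, hiw]
    rw [e, hinp, Nat.testBit_two_pow_mul_add _ hn]
    rcases Nat.lt_or_ge j k with hjk | hjk
    · rw [if_pos hjk]
      have hj' : j < as.length := by rw [G.len]; exact hjk
      have : finOf N hN (L.iw j) = as[j] := Fin.ext (by rw [val_finOf_of_lt hN hiw, G.iw_as j hj'])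
      rw [this, hyas j hj']
    · rw [if_neg (not_lt.2 hjk)]
      rcases Nat.lt_or_ge j (k + 1) with hj1 | hj1
      · have hjk' : j = k := by omega
        subst hjk'
        rw [show finOf N hN (L.iw j) = c from Fin.ext (by rw [val_finOf_of_lt hN hiw, G.iw_c]), hyc, Nat.sub_self, testBit_hiNum_zero]
      · obtain ⟨j', rfl⟩ : ∃ j', j = k + 1 + j' := ⟨j - (k + 1), by omega⟩
        have hj' : j' < ins.length := by omega
        obtain ⟨hia, hic⟩ := G.ins_off _ (List.getElem_mem hj')
        rw [show finOf N hN (L.iw (k + 1 + j')) = ins[j'] from Fin.ext (by rw [val_finOf_of_lt hN hiw, G.iw_ins j' hj']),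
          hyoff _ hia hic, show k + 1 + j' - k = 1 + j' by omega, testBit_hiNum_succ bb z ins j' hj']

/-- The gadget's program is well formed. [folklore] -/
theorem gadgetOps_wf (G : GadgetLayout hN L Wd R F T k as c ins) (b : SLP.BExpr) (hok : b.OK Wd (k + 1 + ins.length))
    (hR : (b.compile Wd 0 0).2.2.1 ≤ R) (hF : (b.compile Wd 0 0).2.2.2 ≤ F) (hT : (b.compile Wd 0 0).1.length ≤ T) :
    ∀ op ∈ gadgetOps hN L b (Wd := Wd), op.WF := by
  intro op hop
  rw [gadgetOps, List.mem_map] at hop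
  obtain ⟨op', hop', rfl⟩ := hop
  have hok' : b.OK Wd L.kIn := by rw [G.kIn]; exact hok
  exact wf_map_finOf hN (SLP.lt_of_mem_wiresOf_compile G.below (b.progWF_compile Wd 0 0 hok' hR hF) hT op' hop')
    (SLP.wf_of_mem_compile G.below.valid (b.progWF_compile Wd 0 0 hok' hR hF) op' hop')

/-- **The gadget's program never targets an input wire** (in particular not the column / selector
wire). [folklore] -/
theorem gadgetOps_target_ne (G : GadgetLayout hN L Wd R F T k as c ins) (b : SLP.BExpr) (hok : b.OK Wd (k + 1 + ins.length))
    (hR : (b.compile Wd 0 0).2.2.1 ≤ R) (hF : (b.compile Wd 0 0).2.2.2 ≤ F) (hT : (b.compile Wd 0 0).1.length ≤ T)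
    {j : ℕ} (hj : j < k + 1 + ins.length) : ∀ op ∈ gadgetOps hN L b (Wd := Wd), op.target ≠ finOf N hN (L.iw j) := by
  intro op hop e
  rw [gadgetOps, List.mem_map] at hop
  obtain ⟨op', hop', rfl⟩ := hop
  have hok' : b.OK Wd L.kIn := by rw [G.kIn]; exact hok
  have hrb := SLP.rb_le_target_of_mem_compile G.below.valid op' hop'
  have hlt : op'.target < N := SLP.lt_of_mem_wiresOf_compile G.below (b.progWF_compile Wd 0 0 hok' hR hF) hT op' hop' _ (by simp)
  have hiw := G.val_lt_rb hj
  rw [ClOp.target_map] at e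
  have := congrArg Fin.val e
  rw [val_finOf_of_lt hN hlt, val_finOf_of_lt hN (G.below.iw_lt j (by rw [G.kIn]; exact hj))] at this
  omega

/-- Layout wires at or above the register base lie in the region. [folklore] -/
theorem mem_layoutRegion_of_layoutWire {i : ℕ} (h : SLP.LayoutWire L Wd R F T i) (hi : ¬ ∃ j, j < L.kIn ∧ i = L.iw j) :
    finOf N hN i ∈ layoutRegion hN L R F T (Wd := Wd) := by
  rcases h with ⟨ρ, j, hρ, hj, rfl⟩ | ⟨φ, hφ, rfl⟩ | ⟨t, o, ht, ho, rfl⟩ | h4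
  · exact regW_mem_layoutRegion hN L hρ hj
  · exact flagW_mem_layoutRegion hN L hφ
  · exact scrW_mem_layoutRegion hN L ht ho
  · exact absurd h4 hi

/-- **All wires of the gadget's program lie in the layout region or among the input wires.**
[folklore] -/
theorem mem_of_mem_wiresOf_gadgetOps (G : GadgetLayout hN L Wd R F T k as c ins) (b : SLP.BExpr) (hok : b.OK Wd (k + 1 + ins.length))
    (hR : (b.compile Wd 0 0).2.2.1 ≤ R) (hF : (b.compile Wd 0 0).2.2.2 ≤ F) (hT : (b.compile Wd 0 0).1.length ≤ T)
    {op : ClOp (Fin N)} (hop : op ∈ gadgetOps hN L b (Wd := Wd)) {x : Fin N} (hx : x ∈ wiresOf op) :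
    x ∈ layoutRegion hN L R F T (Wd := Wd) ∨ x ∈ as ∨ x = c ∨ x ∈ ins := by
  rw [gadgetOps, List.mem_map] at hop
  obtain ⟨op', hop', rfl⟩ := hop
  have hok' : b.OK Wd L.kIn := by rw [G.kIn]; exact hok
  have hwf := b.progWF_compile Wd 0 0 hok' hR hF
  -- `x` is the image of a wire `i` of `op'`
  have hxi : ∃ i ∈ wiresOf op', x = finOf N hN i := by
    cases op' with
    | not i => simp [ClOp.map, mem_wiresOf, ClOp.target, ClOp.controls] at hx; exact ⟨i, by simp [mem_wiresOf, ClOp.target], hx⟩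
    | cnot i i' =>
      simp [ClOp.map, mem_wiresOf, ClOp.target, ClOp.controls] at hx
      rcases hx with rfl | rfl
      · exact ⟨i', by simp [mem_wiresOf, ClOp.target, ClOp.controls], rfl⟩
      · exact ⟨i, by simp [mem_wiresOf, ClOp.target, ClOp.controls], rfl⟩
    | toffoli i i' i'' =>
      simp [ClOp.map, mem_wiresOf, ClOp.target, ClOp.controls] at hx
      rcases hx with rfl | rfl | rfl
      · exact ⟨i'', by simp [mem_wiresOf, ClOp.target, ClOp.controls], rfl⟩
      · exact ⟨i, by simp [mem_wiresOf, ClOp.target, ClOp.controls], rfl⟩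
      · exact ⟨i', by simp [mem_wiresOf, ClOp.target, ClOp.controls], rfl⟩
  obtain ⟨i, hi, rfl⟩ := hxi
  have hLW := SLP.layoutWire_of_mem_wiresOf_compile hwf hT op' hop' i hi
  by_cases hinp : ∃ j, j < L.kIn ∧ i = L.iw j
  · obtain ⟨j, hj, rfl⟩ := hinp
    rw [G.kIn] at hj
    have hiw : L.iw j < N := G.below.iw_lt j (by rw [G.kIn]; exact hj)
    right
    rcases Nat.lt_or_ge j k with hjk | hjk
    · have hj' : j < as.length := by rw [G.len]; exact hjk
      exact Or.inl (by rw [show finOf N hN (L.iw j) = as[j] from Fin.ext (by rw [val_finOf_of_lt hN hiw, G.iw_as j hj'])]; exact List.getElem_mem hj')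
    · rcases Nat.lt_or_ge j (k + 1) with hj1 | hj1
      · have : j = k := by omega
        subst this
        exact Or.inr (Or.inl (Fin.ext (by rw [val_finOf_of_lt hN hiw, G.iw_c])))
      · obtain ⟨j', rfl⟩ : ∃ j', j = k + 1 + j' := ⟨j - (k + 1), by omega⟩
        have hj' : j' < ins.length := by omega
        exact Or.inr (Or.inr (by
          rw [show finOf N hN (L.iw (k + 1 + j')) = ins[j'] from Fin.ext (by rw [val_finOf_of_lt hN hiw, G.iw_ins j' hj'])]
          exact List.getElem_mem hj'))
  · exact Or.inl (mem_layoutRegion_of_layoutWire hLW hinp)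

end Flag

end Literature.Computability.QuantumComplexity
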